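import Summits.KontsevichZagierPeriods.KontsevichZagierPeriods.Theorems.TerasomaMultiplicationBetaCancellationStubPencilSheetsAux

/-!
# `BetaCancellation` (stmt-KontsevichZagierPeriods-13633), line `divisor-slicing-transshipment`:
# stub `stub_pencilSheets` (pencil sheets of a semialgebraic map)

For a `ℚ`-semialgebraic `S ⊆ ℝ^{1+d}` (first coordinate `t`, last `d` coordinates `a`) and a
`ℚ`-semialgebraic map `Ψ` on `S`, for every slope `N : ℕ` and every rational `τ` off a finite
exceptional set, the pencil slice
`Z_τ = {(t, a) ∈ S | cos (N·arctan t + arctan τ) ≠ 0, Ψ(t, a)₀ = tan (N·arctan t + arctan τ)}`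
is covered, for Lebesgue-a.e. `a`, by finitely many `ℚ`-semialgebraic sheets `t = θ_i(a)` over
`ℚ`-semialgebraic pieces, pairwise distinct on overlaps (`stub_pencilSheets`, registered stub of
the line skeleton, signature verbatim).

Proof.
* Trigonometry to algebra (`exists_pencil_polys`, `pencil_iff`): with
  `Q_N(t) = (1+t²)^{N/2} cos (N arctan t)`, `P_N(t) = (1+t²)^{N/2} sin (N arctan t)` — polynomials
  over `ℚ` in `t` by the recursion `Q_{N+1} = Q_N − t P_N`, `P_{N+1} = P_N + t Q_N`
  (`cos (arctan t) = 1/√(1+t²)`, `sin (arctan t) = t/√(1+t²)`) — the slice condition reads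
  `Q_N(t) − τ P_N(t) ≠ 0 ∧ Ψ₀ · (Q_N(t) − τ P_N(t)) = P_N(t) + τ Q_N(t)`, polynomial in `τ` too.
* Hence the total space `W = {(w, τ)} ⊆ ℝ^{(d+1)+1}` of all slices (in the "`t` last" coordinates
  `w = (a, t)` of the tree's cylindrical decomposition) is `ℚ`-semialgebraic
  (`isSemialgebraic_pencilGraph`), and its slices are pairwise disjoint (`pencil_unique`:
  `τ ↦ (P + τQ)/(Q − τP)` is injective), so only finitely many slices have non-empty interior
  (`PencilSheets.finite_setOf_fat_level`): these rational `τ` form the exceptional set.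
* For the other `τ` the slice is a `ℚ`-semialgebraic subset of `ℝ^{d+1}` with empty interior, and
  `PencilSheets.exists_sheets_of_interior_eq_empty` (cylindrical decomposition, Basu–Pollack–Roy
  2006, Cor. 5.7, proved in the tree) gives the sheets; the statement is transported back to the
  "`t` first" coordinates of the stub through the coordinate permutation
  `(a, t) ↦ (t, a) = Fin.append (fun _ => t) a`.

References: S. Basu, R. Pollack, M.-F. Roy, *Algorithms in Real Algebraic Geometry* (2006),
Cor. 5.7; J. Bochnak, M. Coste, M.-F. Roy, *Real Algebraic Geometry* (1998), §2.2.
No definitions are introduced.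
-/

noncomputable section

set_option linter.dupNamespace false

open MeasureTheory Set
open Literature.NumberTheory.Transcendental
open Literature.NumberTheory.Transcendental.KZ
open Literature.ModelTheory.ExponentialFields (IsSemialgebraic isSemialgebraic_univ)

namespace Summit.KontsevichZagierPeriods.KontsevichZagierPeriods.BetaCancellationDivisorSlicing

namespace PencilSheets

open MvPolynomial
open Literature.ModelTheory.ExponentialFields

/-! ## Trigonometry to algebra along the pencil -/

/-- `√(1+t²) · cos (arctan t) = 1`. [folklore] -/
theorem sqrt_mul_cos_arctan (t : ℝ) : √(1 + t ^ 2) * Real.cos (Real.arctan t) = 1 := by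
  have h : 0 < √(1 + t ^ 2) := by positivity
  rw [Real.cos_arctan]
  field_simp

/-- `√(1+t²) · sin (arctan t) = t`. [folklore] -/
theorem sqrt_mul_sin_arctan (t : ℝ) : √(1 + t ^ 2) * Real.sin (Real.arctan t) = t := by
  have h : 0 < √(1 + t ^ 2) := by positivity
  rw [Real.sin_arctan]
  field_simp

/-- **The pencil polynomials.** `Q_N(t) = √(1+t²)^N cos (N arctan t)` and
`P_N(t) = √(1+t²)^N sin (N arctan t)` (real and imaginary parts of `(1 + i t)^N`) are polynomial
functions of the coordinate `t = xᵢ` with rational coefficients: `Q_0 = 1`, `P_0 = 0`,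
`Q_{N+1} = Q_N − t P_N`, `P_{N+1} = P_N + t Q_N` (addition formulas with `√(1+t²) cos (arctan t) = 1`,
`√(1+t²) sin (arctan t) = t`). [folklore] -/
theorem exists_pencil_polys {ι : Type*} (i : ι) : ∀ N : ℕ, ∃ q p : MvPolynomial ι ℚ, ∀ x : ι → ℝ,
    aeval x q = √(1 + x i ^ 2) ^ N * Real.cos (N * Real.arctan (x i)) ∧
    aeval x p = √(1 + x i ^ 2) ^ N * Real.sin (N * Real.arctan (x i))
  | 0 => ⟨1, 0, fun x => by simp⟩
  | N + 1 => by
    obtain ⟨q, p, h⟩ := exists_pencil_polys i N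
    refine ⟨q - X i * p, p + X i * q, fun x => ?_⟩
    obtain ⟨hq, hp⟩ := h x
    have h1 := sqrt_mul_cos_arctan (x i)
    have h2 := sqrt_mul_sin_arctan (x i)
    simp only [map_sub, map_add, map_mul, aeval_X, hq, hp, Nat.cast_succ, add_mul, one_mul,
      Real.cos_add, Real.sin_add, pow_succ (√(1 + x i ^ 2)) N]
    constructor
    · linear_combination -(√(1 + x i ^ 2) ^ N * Real.cos (↑N * Real.arctan (x i))) * h1 +
        (√(1 + x i ^ 2) ^ N * Real.sin (↑N * Real.arctan (x i))) * h2
    · linear_combination -(√(1 + x i ^ 2) ^ N * Real.sin (↑N * Real.arctan (x i))) * h1 -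
        (√(1 + x i ^ 2) ^ N * Real.cos (↑N * Real.arctan (x i))) * h2

/-- **The pencil condition is algebraic.** With `Q = √(1+t²)^N cos (N arctan t)`,
`P = √(1+t²)^N sin (N arctan t)`: `cos (N arctan t + arctan τ) ≠ 0 ∧ y = tan (N arctan t + arctan τ)`
iff `Q − τP ≠ 0 ∧ y (Q − τP) = P + τQ`, because
`√(1+t²)^N √(1+τ²) cos (N arctan t + arctan τ) = Q − τ P` and
`√(1+t²)^N √(1+τ²) sin (N arctan t + arctan τ) = P + τ Q`. [folklore] -/
theorem pencil_iff (N : ℕ) (t τ y : ℝ) :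
    (Real.cos (N * Real.arctan t + Real.arctan τ) ≠ 0 ∧
      y = Real.tan (N * Real.arctan t + Real.arctan τ)) ↔
    (√(1 + t ^ 2) ^ N * Real.cos (N * Real.arctan t) -
        τ * (√(1 + t ^ 2) ^ N * Real.sin (N * Real.arctan t)) ≠ 0 ∧
      y * (√(1 + t ^ 2) ^ N * Real.cos (N * Real.arctan t) -
        τ * (√(1 + t ^ 2) ^ N * Real.sin (N * Real.arctan t))) =
        √(1 + t ^ 2) ^ N * Real.sin (N * Real.arctan t) +
          τ * (√(1 + t ^ 2) ^ N * Real.cos (N * Real.arctan t))) := by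
  set r := √(1 + t ^ 2) with hr
  set s := √(1 + τ ^ 2) with hs
  set φ := (N : ℝ) * Real.arctan t with hφ
  have hs0 : 0 < s := by positivity
  have hc : s * Real.cos (Real.arctan τ) = 1 := sqrt_mul_cos_arctan τ
  have hsn : s * Real.sin (Real.arctan τ) = τ := sqrt_mul_sin_arctan τ
  have hpos : 0 < r ^ N * s := by positivity
  have hcos : Real.cos (φ + Real.arctan τ) * (r ^ N * s) =
      r ^ N * Real.cos φ - τ * (r ^ N * Real.sin φ) := by
    rw [Real.cos_add]
    linear_combination (r ^ N * Real.cos φ) * hc - (r ^ N * Real.sin φ) * hsn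
  have hsin : Real.sin (φ + Real.arctan τ) * (r ^ N * s) =
      r ^ N * Real.sin φ + τ * (r ^ N * Real.cos φ) := by
    rw [Real.sin_add]
    linear_combination (r ^ N * Real.sin φ) * hc + (r ^ N * Real.cos φ) * hsn
  rw [← hcos, ← hsin]
  constructor
  · rintro ⟨hc0, rfl⟩
    refine ⟨mul_ne_zero hc0 hpos.ne', ?_⟩
    rw [Real.tan_eq_sin_div_cos]
    field_simp
  · rintro ⟨hne, hy⟩
    have hc0 : Real.cos (φ + Real.arctan τ) ≠ 0 := fun h => hne (by rw [h, zero_mul])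
    refine ⟨hc0, ?_⟩
    rw [Real.tan_eq_sin_div_cos, eq_div_iff hc0]
    refine mul_right_cancel₀ hpos.ne' ?_
    rw [mul_assoc]
    exact hy

/-- **Distinct pencil parameters give disjoint slices**: if `Q − τP ≠ 0`, `Q − τ'P ≠ 0`,
`y (Q − τP) = P + τQ` and `y (Q − τ'P) = P + τ'Q` then `τ = τ'` (otherwise `(1 + y²) P = 0`, then
`Q = 0`, contradicting `Q − τP ≠ 0`). [folklore] -/
theorem pencil_unique {Q P y τ τ' : ℝ} (h1 : Q - τ * P ≠ 0) (h2 : Q - τ' * P ≠ 0)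
    (e1 : y * (Q - τ * P) = P + τ * Q) (e2 : y * (Q - τ' * P) = P + τ' * Q) : τ = τ' := by
  by_contra hne
  have hτ : τ - τ' ≠ 0 := sub_ne_zero.mpr hne
  have hP : (τ - τ') * ((1 + y ^ 2) * P) = 0 := by
    linear_combination (y - τ) * e2 - (y - τ') * e1
  have hP0 : P = 0 := by
    rcases mul_eq_zero.mp hP with h | h
    · exact absurd h hτ
    · rcases mul_eq_zero.mp h with h' | h'
      · exact absurd h' (by positivity)
      · exact h'
  subst hP0
  have hQ : (τ - τ') * Q = 0 := by linear_combination e2 - e1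
  have hQ0 : Q = 0 := by
    rcases mul_eq_zero.mp hQ with h | h
    · exact absurd h hτ
    · exact h
  apply h1
  rw [hQ0, mul_zero, sub_zero]

/-- **The total space of the pencil slices is semialgebraic.** For `S' ⊆ ℝⁿ` `ℚ`-semialgebraic,
`ψ` a `ℚ`-semialgebraic function on `S'` and `Q`, `P` polynomial functions on `ℝⁿ⁺¹` with rational
coefficients, the set `{(w, τ) | w ∈ S', Q − τP ≠ 0, ψ(w) (Q − τP) = P + τQ} ⊆ ℝⁿ⁺¹` (`τ` the last
coordinate) is `ℚ`-semialgebraic (products and differences of semialgebraic functions and their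
equalisers: Tarski–Seidenberg, `IsSemialgebraicFunOn.mul_holds`/`sub_holds`,
`isSemialgebraic_sep_snoc_mem`). [folklore] -/
theorem isSemialgebraic_pencilGraph {n : ℕ} {S' : Set (Fin n → ℝ)} (hS' : IsSemialgebraic ℚ S')
    {ψ : (Fin n → ℝ) → ℝ} (hψ : IsSemialgebraicFunOn ℚ S' ψ) {Q P : (Fin (n + 1) → ℝ) → ℝ}
    (hQ : ∃ q : MvPolynomial (Fin (n + 1)) ℚ, ∀ v, aeval v q = Q v)
    (hP : ∃ p : MvPolynomial (Fin (n + 1)) ℚ, ∀ v, aeval v p = P v) :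
    IsSemialgebraic ℚ {v : Fin (n + 1) → ℝ | Fin.init v ∈ S' ∧
      Q v - v (Fin.last n) * P v ≠ 0 ∧
      ψ (Fin.init v) * (Q v - v (Fin.last n) * P v) = P v + v (Fin.last n) * Q v} := by
  obtain ⟨q, hq⟩ := hQ
  obtain ⟨p, hp⟩ := hP
  have hS'' : IsSemialgebraic ℚ {v : Fin (n + 1) → ℝ | Fin.init v ∈ S'} := hS'.setOf_init_mem
  have hψ' : IsSemialgebraicFunOn ℚ {v : Fin (n + 1) → ℝ | Fin.init v ∈ S'} fun v => ψ (Fin.init v) :=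
    hψ.comp_init
  have hf₁ : IsSemialgebraicFunOn ℚ {v : Fin (n + 1) → ℝ | Fin.init v ∈ S'}
      fun v => Q v - v (Fin.last n) * P v :=
    (isSemialgebraicFunOn_aeval hS'' (q - X (Fin.last n) * p)).congr fun v _ => by
      simp [hq, hp]
  have hf₂ : IsSemialgebraicFunOn ℚ {v : Fin (n + 1) → ℝ | Fin.init v ∈ S'}
      fun v => P v + v (Fin.last n) * Q v :=
    (isSemialgebraicFunOn_aeval hS'' (p + X (Fin.last n) * q)).congr fun v _ => by
      simp [hq, hp]
  have hg : IsSemialgebraicFunOn ℚ {v : Fin (n + 1) → ℝ | Fin.init v ∈ S'}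
      ((fun v => ψ (Fin.init v)) * (fun v => Q v - v (Fin.last n) * P v) -
        fun v => P v + v (Fin.last n) * Q v) :=
    IsSemialgebraicFunOn.sub_holds (IsSemialgebraicFunOn.mul_holds hψ' hf₁) hf₂
  have hT : IsSemialgebraic ℚ {z : Fin (n + 1 + 1) → ℝ | z (Fin.last (n + 1)) = 0} := by
    simpa using isSemialgebraic_setOf_eval_eq_zero (k := ℚ) (R := ℝ)
      (X (Fin.last (n + 1)) : MvPolynomial (Fin (n + 1 + 1)) ℚ)
  have hZ := hg.isSemialgebraic_sep_snoc_mem tarski_seidenberg_real_holds hT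
  have hne : IsSemialgebraic ℚ {v : Fin (n + 1) → ℝ | Q v - v (Fin.last n) * P v ≠ 0} := by
    convert isSemialgebraic_setOf_eval_ne_zero (k := ℚ) (R := ℝ) (q - X (Fin.last n) * p) using 2
      with v
    simp [hq, hp]
  convert hne.inter hZ using 1
  ext v
  simp only [mem_setOf_eq, mem_inter_iff, Fin.snoc_last, Pi.sub_apply, Pi.mul_apply, sub_eq_zero]
  tauto

end PencilSheets

open PencilSheets

/-- **Pencil sheets of a semialgebraic map** (registered stub `stub_pencilSheets` of the line
`divisor-slicing-transshipment`, signature verbatim). For a `ℚ`-semialgebraic `S ⊆ ℝ^{1+d}` and a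
`ℚ`-semialgebraic map `Ψ` on `S`, for every slope `N` and all but finitely many rational `τ`, the
slice `{(t, a) ∈ S : cos (N·arctan t + arctan τ) ≠ 0, Ψ(t,a)₀ = tan (N·arctan t + arctan τ)}` is
covered, for a.e. `a`, by finitely many `ℚ`-semialgebraic sheets `t = θ_i(a)` over
`ℚ`-semialgebraic pieces `U_i`, pairwise distinct on overlaps. Proof: the slice condition is
algebraic (`pencil_iff`), the slices for distinct `τ` are disjoint (`pencil_unique`), so all but
finitely many slices have empty interior (`PencilSheets.finite_setOf_fat_level`), and a thin
`ℚ`-semialgebraic slice has the sheet structure by cylindrical decomposition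
(`PencilSheets.exists_sheets_of_interior_eq_empty`; Basu–Pollack–Roy 2006, Cor. 5.7).
[folklore] -/
theorem stub_pencilSheets : ∀ (d : ℕ) (S : Set (Fin (1 + d) → ℝ)) (Ψ : (Fin (1 + d) → ℝ) → (Fin (1 + d) → ℝ)), IsSemialgebraic ℚ S → IsSemialgebraicMapOn ℚ S Ψ → ∀ N : ℕ, ∃ E : Finset ℚ, ∀ τ : ℚ, τ ∉ E → ∃ (m : ℕ) (U : Fin m → Set (Fin d → ℝ)) (θ : Fin m → (Fin d → ℝ) → ℝ), (∀ i, IsSemialgebraic ℚ (U i) ∧ IsSemialgebraicFunOn ℚ (U i) (θ i)) ∧ (∀ i, ∀ a ∈ U i, Fin.append (fun _ : Fin 1 => θ i a) a ∈ S ∧ Real.cos ((N : ℝ) * Real.arctan (θ i a) + Real.arctan (τ : ℝ)) ≠ 0 ∧ Ψ (Fin.append (fun _ : Fin 1 => θ i a) a) (Fin.castAdd d 0) = Real.tan ((N : ℝ) * Real.arctan (θ i a) + Real.arctan (τ : ℝ))) ∧ (∀ i i', i ≠ i' → ∀ a ∈ U i ∩ U i', θ i a ≠ θ i' a) ∧ volume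 {a : Fin d → ℝ | ∃ t : ℝ, Fin.append (fun _ : Fin 1 => t) a ∈ S ∧ Real.cos ((N : ℝ) * Real.arctan t + Real.arctan (τ : ℝ)) ≠ 0 ∧ Ψ (Fin.append (fun _ : Fin 1 => t) a) (Fin.castAdd d 0) = Real.tan ((N : ℝ) * Real.arctan t + Real.arctan (τ : ℝ)) ∧ ∀ i, ¬ (a ∈ U i ∧ θ i a = t)} = 0 := by
  intro d S Ψ hS hΨ N
  classical
  -- the coordinate permutation `(a, t) ↦ (t, a)`: `w ∘ π = Fin.append (fun _ => w last) (Fin.init w)`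
  set π : Fin (1 + d) → Fin (d + 1) := Fin.append (fun _ : Fin 1 => Fin.last d) Fin.castSucc with hπ
  have hsnocπ : ∀ (a : Fin d → ℝ) (t : ℝ),
      (Fin.snoc a t : Fin (d + 1) → ℝ) ∘ π = Fin.append (fun _ : Fin 1 => t) a := by
    intro a t
    funext i
    refine Fin.addCases (fun j => ?_) (fun j => ?_) i
    · simp [hπ]
    · simp [hπ]
  set S' : Set (Fin (d + 1) → ℝ) := (fun w : Fin (d + 1) → ℝ => w ∘ π) ⁻¹' S with hS'
  have hS'sa : IsSemialgebraic ℚ S' := hS.preimage_comp π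
  set ψ : (Fin (d + 1) → ℝ) → ℝ := fun w => Ψ (w ∘ π) (Fin.castAdd d 0) with hψ
  have hψsa : IsSemialgebraicFunOn ℚ S' ψ := by
    have h0 : IsSemialgebraicFunOn ℚ S (fun x => Ψ x (Fin.castAdd d 0)) :=
      ((isSemialgebraicMapOn_iff_forall_holds hS).mp hΨ) _
    have hmap : IsSemialgebraicMapOn ℚ S' (fun w : Fin (d + 1) → ℝ => w ∘ π) := by
      convert isSemialgebraicMapOn_aeval hS'sa
        (fun j => (MvPolynomial.X (π j) : MvPolynomial (Fin (d + 1)) ℚ)) using 2 with w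
      funext j
      simp
    exact IsSemialgebraicFunOn.comp_isSemialgebraicMapOn_holds h0 hmap fun w hw => hw
  -- the pencil polynomials in the coordinate `t = v (castSucc (last d))` of `v = (a, t, τ)`
  obtain ⟨q, p, hqp⟩ :=
    exists_pencil_polys (ι := Fin (d + 1 + 1)) (Fin.castSucc (Fin.last d)) N
  -- the total space of the slices, `τ` last
  set W : Set (Fin (d + 1 + 1) → ℝ) := {v | Fin.init v ∈ S' ∧
    √(1 + v (Fin.castSucc (Fin.last d)) ^ 2) ^ N *
          Real.cos (N * Real.arctan (v (Fin.castSucc (Fin.last d)))) -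
        v (Fin.last (d + 1)) * (√(1 + v (Fin.castSucc (Fin.last d)) ^ 2) ^ N *
          Real.sin (N * Real.arctan (v (Fin.castSucc (Fin.last d))))) ≠ 0 ∧
    ψ (Fin.init v) * (√(1 + v (Fin.castSucc (Fin.last d)) ^ 2) ^ N *
          Real.cos (N * Real.arctan (v (Fin.castSucc (Fin.last d)))) -
        v (Fin.last (d + 1)) * (√(1 + v (Fin.castSucc (Fin.last d)) ^ 2) ^ N *
          Real.sin (N * Real.arctan (v (Fin.castSucc (Fin.last d)))))) =
      √(1 + v (Fin.castSucc (Fin.last d)) ^ 2) ^ N *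
          Real.sin (N * Real.arctan (v (Fin.castSucc (Fin.last d)))) +
        v (Fin.last (d + 1)) * (√(1 + v (Fin.castSucc (Fin.last d)) ^ 2) ^ N *
          Real.cos (N * Real.arctan (v (Fin.castSucc (Fin.last d)))))} with hW
  have hWsa : IsSemialgebraic ℚ W :=
    isSemialgebraic_pencilGraph hS'sa hψsa ⟨q, fun v => (hqp v).1⟩ ⟨p, fun v => (hqp v).2⟩
  have hmemW : ∀ (w : Fin (d + 1) → ℝ) (τ : ℝ), (Fin.snoc w τ : Fin (d + 1 + 1) → ℝ) ∈ W ↔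
      w ∈ S' ∧
      √(1 + w (Fin.last d) ^ 2) ^ N * Real.cos (N * Real.arctan (w (Fin.last d))) -
          τ * (√(1 + w (Fin.last d) ^ 2) ^ N * Real.sin (N * Real.arctan (w (Fin.last d)))) ≠ 0 ∧
      ψ w * (√(1 + w (Fin.last d) ^ 2) ^ N * Real.cos (N * Real.arctan (w (Fin.last d))) -
          τ * (√(1 + w (Fin.last d) ^ 2) ^ N * Real.sin (N * Real.arctan (w (Fin.last d))))) =
        √(1 + w (Fin.last d) ^ 2) ^ N * Real.sin (N * Real.arctan (w (Fin.last d))) +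
          τ * (√(1 + w (Fin.last d) ^ 2) ^ N * Real.cos (N * Real.arctan (w (Fin.last d)))) := by
    intro w τ
    simp only [hW, mem_setOf_eq, Fin.init_snoc, Fin.snoc_last, Fin.snoc_castSucc]
  have hdisj : ∀ (w : Fin (d + 1) → ℝ) (τ τ' : ℝ), (Fin.snoc w τ : Fin (d + 1 + 1) → ℝ) ∈ W →
      (Fin.snoc w τ' : Fin (d + 1 + 1) → ℝ) ∈ W → τ = τ' := by
    intro w τ τ' h h'
    rw [hmemW] at h h'
    exact pencil_unique h.2.1 h'.2.1 h.2.2 h'.2.2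
  have hfin := finite_setOf_fat_level hWsa hdisj
  -- the exceptional set: rational heights of the fat slices
  refine ⟨(hfin.preimage ((Rat.cast_injective (α := ℝ)).injOn)).toFinset, fun τ hτ => ?_⟩
  rw [Set.Finite.mem_toFinset, mem_preimage, mem_setOf_eq, not_nonempty_iff_eq_empty] at hτ
  set σ : Set (Fin (d + 1) → ℝ) :=
    {w | (Fin.snoc w ((τ : ℚ) : ℝ) : Fin (d + 1 + 1) → ℝ) ∈ W} with hσ
  have hσsa : IsSemialgebraic ℚ σ := by
    have h := hWsa.preimage_aeval
      (Fin.snoc (fun i => (MvPolynomial.X i : MvPolynomial (Fin (d + 1)) ℚ)) (MvPolynomial.C τ) :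
        Fin (d + 1 + 1) → MvPolynomial (Fin (d + 1)) ℚ)
    convert h using 1
    ext w
    simp only [hσ, mem_setOf_eq, mem_preimage]
    have hv : (fun j => MvPolynomial.aeval w
        ((Fin.snoc (fun i => (MvPolynomial.X i : MvPolynomial (Fin (d + 1)) ℚ)) (MvPolynomial.C τ) :
          Fin (d + 1 + 1) → MvPolynomial (Fin (d + 1)) ℚ) j)) =
        (Fin.snoc w ((τ : ℚ) : ℝ) : Fin (d + 1 + 1) → ℝ) := by
      funext j
      refine Fin.lastCases ?_ (fun i => ?_) j
      · simp
      · simp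
    rw [hv]
  obtain ⟨m, U, θ, hUθ, hsheet, hdist, hcov⟩ := exists_sheets_of_interior_eq_empty hσsa hτ
  -- back to the coordinates of the statement
  have hmemσ : ∀ (a : Fin d → ℝ) (t : ℝ), (Fin.snoc a t : Fin (d + 1) → ℝ) ∈ σ ↔
      Fin.append (fun _ : Fin 1 => t) a ∈ S ∧
      Real.cos ((N : ℝ) * Real.arctan t + Real.arctan (τ : ℝ)) ≠ 0 ∧
      Ψ (Fin.append (fun _ : Fin 1 => t) a) (Fin.castAdd d 0) =
        Real.tan ((N : ℝ) * Real.arctan t + Real.arctan (τ : ℝ)) := by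
    intro a t
    rw [hσ, mem_setOf_eq, hmemW]
    simp only [hS', hψ, mem_preimage, hsnocπ, Fin.snoc_last]
    exact and_congr_right fun _ => (pencil_iff N t τ _).symm
  refine ⟨m, U, θ, hUθ, fun i a ha => (hmemσ a _).mp (hsheet i a ha), hdist, ?_⟩
  have hset : {a : Fin d → ℝ | ∃ t : ℝ, Fin.append (fun _ : Fin 1 => t) a ∈ S ∧
      Real.cos ((N : ℝ) * Real.arctan t + Real.arctan (τ : ℝ)) ≠ 0 ∧
      Ψ (Fin.append (fun _ : Fin 1 => t) a) (Fin.castAdd d 0) =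
        Real.tan ((N : ℝ) * Real.arctan t + Real.arctan (τ : ℝ)) ∧ ∀ i, ¬ (a ∈ U i ∧ θ i a = t)} =
      {a : Fin d → ℝ | ∃ t : ℝ, (Fin.snoc a t : Fin (d + 1) → ℝ) ∈ σ ∧
        ∀ i, ¬ (a ∈ U i ∧ θ i a = t)} := by
    ext a
    simp only [mem_setOf_eq, hmemσ, and_assoc]
  rw [hset]
  exact hcov

end Summit.KontsevichZagierPeriods.KontsevichZagierPeriods.BetaCancellationDivisorSlicing
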